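import Mathlib

/-!
# `BalabanUV.Beta.GAN24.CrossedPatternCount` — binder row G-an2-4 ∕ (CONV-C), W-slot (α-0), ROW (C)sym AT LEVELS `≥ 1`, the VALUE LEDGER
# (RULING R-gan24p1-g40-1 §1 R4; leaf-03 g71∕g72's crossed ledger; leaf-06 g56∕g57's depth-tower values): **THE ADAPTER COUNT `8`** — the crossed orbit sum of a
# bond-symmetrised face read whose entries open into «direct word + swapped word − W word» picks up EXACTLY `8 ×` the one off-diagonal word value
# (G-an2-4 OWNER `b2b-balaban-gan24-p1`, gen 41; journal [GAN24P1-G41-INTENT1])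

NOT IN PRINT; OUR BOOKKEEPING ([folklore] finite index algebra — one `ring`, four `linear_combination`s; 0 `def`, 0 cited fact, 0 `def … : Prop`, 0 sorry; `import Mathlib` only).
HONEST FRAMING (cell contract, verbatim): «discharging `BetaPertH` makes Bałaban's UV stability UNCONDITIONAL — a real constructive-QFT result; it is NOT the continuum
limit and NOT the Clay problem.»  HONEST DEPENDENCY (verbatim): «continuum YM on T⁴ ⇐ BetaPertH ∧ nine spine estimates (0/9 proved); BetaPertH ⇐ (D1) ∧ (D4) ∧ CAP+tail;
G-an2-4 gates asym, D1 and NE2/3/4.»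

WHY.  Road-P2's crossed ledger `hXu` reads, per level and period, the CROSSED ORBIT SUM `X(Y)(a,b) := Y(a,b;a,b) + Y(b,a;a,b) + (Y(a,b;b,a) + Y(b,a;b,a))` of the
bond-symmetrised face read `Y(κ,κ′;κ₁,κ₂) = FF(κκ′;κ₁κ₂) + FF(κ′κ;κ₁κ₂)` (`CombChargeTowerClosure`, `CrossedLedgerForcingCumulative`).  leaf-02 g69's Part 47
(`FourFaceSourceWordsDeep.faceRead_dressedSource_inl_inl`) opens each entry of the forcing's face read as `κ₀·(D(μν;αβ) + D(νμ;αβ) − W(μν;αβ))` — the direct exchange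
word (left vertex on bond `μ` with leg `α`, right vertex on bond `ν` with leg `β`), the bond-swapped word, and the `W` word; leaf-06 g56∕g57 VALUE the direct word:
it vanishes on the diagonal patterns (`FaceWordEEDiagDeep ∕ …Zero`; only `μ = α` is met by the crossed orbit) and takes one common value `v` on the two off-diagonal crossed patterns `(b,a;a,b)`,
`(a,b;b,a)` (`FaceWordEEValueDeep ∕ …Zero` with `WilsonProfilePairing`: the pair tensor is `−1` on both); leaf-02's Parts 48∕50b make the `W` word null in the
leg-and-bond symmetrised combination.  leaf-06 g57's R-leaf06-g57-1 then READS the adapter count «`8 = 2 × 4`» by hand.  THIS FILE types that count once, for any index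
type and any entries, with the four structural facts as DISPLAYED HYPOTHESES — so the adapter (road-P2's socket) instantiates it instead of re-counting.

WHAT ([folklore]; `ι` any type, `FF D W : ι → ι → ι → ι → ℝ`, scalars `κ₀ v`, two indices `a b`):
* `crossed_bondSym_eq_two_mul` — NO hypothesis: `X(FF + FFᵇ)(a,b) = 2·(FF(ab;ab) + FF(ba;ab) + FF(ab;ba) + FF(ba;ba))` (the crossed orbit is closed under the bond swap);
* `crossed_orbit_of_words` — given the opening `FF = κ₀·(D + Dᵇ − W)`, the left-diagonal zeros of `D` (`D(μν;μβ) = 0`), its two off-diagonal crossed values `v₁ := D(ba;ab)`,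
  `v₂ := D(ab;ba)`, and the `W` word's null crossed orbit: `FF(ab;ab) + FF(ba;ab) + FF(ab;ba) + FF(ba;ba) = 2·κ₀·(v₁ + v₂)`;
* **`crossed_bondSym_of_words`** — hence `X(FF + FFᵇ)(a,b) = 4·κ₀·(v₁ + v₂)`;
* `crossed_orbit_of_words_eq` ∕ **`crossed_bondSym_of_words_eq`** — with ONE common value `v₁ = v₂ = v`: `4·κ₀·v` ∕ `8·κ₀·v` (the displayed count).
v1.1 (before filing, on leaf-03 g73's X-read ι-1 ∕ M4, § C-leaf03g73-1): TWO value letters `v₁ v₂` — the suppliers display the deeper Green's-function pairing with the two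
profiles EXCHANGED between the two patterns and never evaluate it, so asking `v₁ = v₂` as expressions would put an untyped symmetry lemma on the adapter; the ledger's potential form
runs on the pattern-pair SUM anyway (g55 `crossed_zmode_forcing_succ`, leaf-03 `CrossedLedgerClosure` §1).
Asserts NO value and NO shape of Bałaban's tables (every structural fact is a hypothesis); discharges NOTHING of `hX` ∕ `hXu` ∕ (C)_{≥1} ∕ `hB0` ∕ `hBF` ∕ (Q-L);
NEVER «G-an2-4 closed» as (CONV-C); NOT D1, NOT `BetaPertH`, NOT continuum, NOT Clay.  2026-08-24; no existing file touched.
-/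

namespace Summit.QuantumFields.BalabanUV.Beta.GAN24.CrossedPatternCount

variable {ι : Type*}

/-- [folklore] **THE CROSSED ORBIT OF A BOND-SYMMETRISED READ IS TWICE THE CROSSED ORBIT OF THE READ** (no hypothesis): with `Y(κ,κ′;κ₁,κ₂) := FF κ κ′ κ₁ κ₂ + FF κ′ κ κ₁ κ₂`,
`Y(a,b;a,b) + Y(b,a;a,b) + (Y(a,b;b,a) + Y(b,a;b,a)) = 2·(FF(ab;ab) + FF(ba;ab) + FF(ab;ba) + FF(ba;ba))` — the four crossed patterns are closed under the bond swap. -/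
theorem crossed_bondSym_eq_two_mul (FF : ι → ι → ι → ι → ℝ) (a b : ι) :
    (FF a b a b + FF b a a b) + (FF b a a b + FF a b a b) + ((FF a b b a + FF b a b a) + (FF b a b a + FF a b b a)) =
      2 * (FF a b a b + FF b a a b + FF a b b a + FF b a b a) := by
  ring

/-- [folklore] **THE CROSSED ORBIT OF A READ THAT OPENS INTO «DIRECT + SWAPPED − W» WORDS IS `2·κ₀·(v₁ + v₂)`**: if every entry is
`FF(μν;αβ) = κ₀·(D(μν;αβ) + D(νμ;αβ) − W(μν;αβ))` (direct word: left vertex on bond `μ` with leg `α`, right vertex on bond `ν` with leg `β`; the swapped word is the direct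
word with the bonds exchanged), the direct word VANISHES on the left-diagonal patterns `μ = α` (the only diagonal the crossed orbit meets), takes the values `v₁` on `(b,a;a,b)` and
`v₂` on `(a,b;b,a)`, and the `W` word's crossed orbit is null, then `FF(ab;ab) + FF(ba;ab) + FF(ab;ba) + FF(ba;ba) = 2·κ₀·(v₁ + v₂)` — each of the four patterns carries exactly
ONE non-diagonal word (twice `v₁`, twice `v₂`).  This is also the CELL (un-symmetrised) orbit's count. -/
theorem crossed_orbit_of_words (FF D W : ι → ι → ι → ι → ℝ) (κ₀ v₁ v₂ : ℝ) (a b : ι)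
    (hFF : ∀ μ ν α β : ι, FF μ ν α β = κ₀ * (D μ ν α β + D ν μ α β - W μ ν α β))
    (hDl : ∀ μ ν β : ι, D μ ν μ β = 0)
    (hv₁ : D b a a b = v₁) (hv₂ : D a b b a = v₂)
    (hW : W a b a b + W b a a b + (W a b b a + W b a b a) = 0) :
    FF a b a b + FF b a a b + FF a b b a + FF b a b a = 2 * κ₀ * (v₁ + v₂) := by
  rw [hFF a b a b, hFF b a a b, hFF a b b a, hFF b a b a, hDl a b b, hDl b a a, hv₁, hv₂]
  linear_combination (-κ₀) * hW

/-- NOT IN PRINT; OUR BOOKKEEPING.  **THE BOND-SYMMETRISED CROSSED ORBIT IS `4·κ₀·(v₁ + v₂)`**: under the hypotheses of `crossed_orbit_of_words`, the crossed orbit sum of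
`Y(κ,κ′;κ₁,κ₂) := FF κ κ′ κ₁ κ₂ + FF κ′ κ κ₁ κ₂` — road-P2's `X(FFsym)(a,b)` spelling `Y a b a b + Y b a a b + (Y a b b a + Y b a b a)` — equals `4·κ₀·(v₁ + v₂)`
(`2` from the bond symmetrisation × the 4-pattern orbit).  leaf-03 g73's M4 shape (X-read § C-leaf03g73-1). -/
theorem crossed_bondSym_of_words (FF D W : ι → ι → ι → ι → ℝ) (κ₀ v₁ v₂ : ℝ) (a b : ι)
    (hFF : ∀ μ ν α β : ι, FF μ ν α β = κ₀ * (D μ ν α β + D ν μ α β - W μ ν α β))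
    (hDl : ∀ μ ν β : ι, D μ ν μ β = 0)
    (hv₁ : D b a a b = v₁) (hv₂ : D a b b a = v₂)
    (hW : W a b a b + W b a a b + (W a b b a + W b a b a) = 0) :
    (FF a b a b + FF b a a b) + (FF b a a b + FF a b a b) + ((FF a b b a + FF b a b a) + (FF b a b a + FF a b b a)) = 4 * κ₀ * (v₁ + v₂) := by
  rw [crossed_bondSym_eq_two_mul]
  linear_combination (2 : ℝ) * crossed_orbit_of_words FF D W κ₀ v₁ v₂ a b hFF hDl hv₁ hv₂ hW

/-- [folklore] The un-symmetrised orbit with ONE common off-diagonal value `v₁ = v₂ = v`: `FF(ab;ab) + FF(ba;ab) + FF(ab;ba) + FF(ba;ba) = 4·κ₀·v` (the cell count `4`). -/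
theorem crossed_orbit_of_words_eq (FF D W : ι → ι → ι → ι → ℝ) (κ₀ v : ℝ) (a b : ι)
    (hFF : ∀ μ ν α β : ι, FF μ ν α β = κ₀ * (D μ ν α β + D ν μ α β - W μ ν α β))
    (hDl : ∀ μ ν β : ι, D μ ν μ β = 0)
    (hv₁ : D b a a b = v) (hv₂ : D a b b a = v)
    (hW : W a b a b + W b a a b + (W a b b a + W b a b a) = 0) :
    FF a b a b + FF b a a b + FF a b b a + FF b a b a = 4 * κ₀ * v := by
  linear_combination crossed_orbit_of_words FF D W κ₀ v v a b hFF hDl hv₁ hv₂ hW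

/-- NOT IN PRINT; OUR BOOKKEEPING.  **THE ADAPTER COUNT `8`**: with ONE common off-diagonal value `v₁ = v₂ = v` the bond-symmetrised crossed orbit is `8·κ₀·v`
(`2` × `4` × one word each) — leaf-06 g57's hand count R-leaf06-g57-1, kernel-checked in the abstract (use `crossed_bondSym_of_words` when the two pattern values are kept apart). -/
theorem crossed_bondSym_of_words_eq (FF D W : ι → ι → ι → ι → ℝ) (κ₀ v : ℝ) (a b : ι)
    (hFF : ∀ μ ν α β : ι, FF μ ν α β = κ₀ * (D μ ν α β + D ν μ α β - W μ ν α β))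
    (hDl : ∀ μ ν β : ι, D μ ν μ β = 0)
    (hv₁ : D b a a b = v) (hv₂ : D a b b a = v)
    (hW : W a b a b + W b a a b + (W a b b a + W b a b a) = 0) :
    (FF a b a b + FF b a a b) + (FF b a a b + FF a b a b) + ((FF a b b a + FF b a b a) + (FF b a b a + FF a b b a)) = 8 * κ₀ * v := by
  linear_combination crossed_bondSym_of_words FF D W κ₀ v v a b hFF hDl hv₁ hv₂ hW

end Summit.QuantumFields.BalabanUV.Beta.GAN24.CrossedPatternCount
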